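import Summits.CriticalPhenomena.SAWScalingLimit.Theses.SAWIsotropicAnchor
import Summits.CriticalPhenomena.SAWScalingLimit.Theorems.SAWLoopFugacityFlowSimpleSubseqLimitsFarReturnPassage
import Summits.CriticalPhenomena.SAWScalingLimit.Theorems.SAWLoopFugacityFlowSimpleSubseqLimitsBoundaryPassage
import HarnessLib

/-!
# Birth skeleton for the split child X4 `AnchorSimpleBoundary` of `AnchorAxiomsOfLimit` (stmt-CriticalPhenomena-7299)

`AnchorSimpleBoundary` (fourth child of the strategist's split, route SAWIsotropicAnchor; =
`stub_anchorSimpleBoundary` of `Lines/split.lean`): every chordal full scaling limit `P` of the critical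
freely-jointed non-crossing chain is carried, in every Dobrushin domain, by SIMPLE curve classes meeting
`∂D` only at the marked points.

## The cut (off-lattice twin of `Cruxes/SimpleOfLimit/Lines/birth.lean`): two `ℓ`-uniform estimates on
## OPEN macroscopic events of the chain law + a soft passage

`CurveClass.simple` is not closed (tree: `SimpleSubseqLimits.Negative.SimpleNotClosed`), so nothing soft
passes to the limit; the content is a pair of `ℓ`-UNIFORM ESTIMATES of the critical chain law on the SAME
open events the lattice programme isolated (`nearFarReturnEvent`, `nearBoundaryVisitEvent`, Theorems files
`SAWLoopFugacityFlowSimpleSubseqLimits{FarReturn,Boundary}Passage.lean`), followed by the open-set portmanteau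
and the deterministic closing lemmas landed there (guarded Rohde–Schramm closing; `1`-Lipschitz `infDist`).

* S1 `stub_anchorFarReturnDecay` (OPEN, L–XL) — ORDER ("no macroscopic near-self-touching") for the chain:
  along every admissible approximation, for every ball `B̄(q, r)` and `θ > 0` there are `ε, r₀ < r < r'` with,
  eventually as `ℓ → 0⁺`, `fjc`-probability `≤ θ` that the chain, after its first entrance into `B(q, r')`,
  comes `ε`-close to a past value taken outside the guard ball. No Kesten-pattern / DCH13 analogue off
  lattice is in print (the crux's recorded why-might-fail lives here).
* S2 `stub_anchorBoundaryDecay` (OPEN, L) — BOUNDARY ("no boundary crawling"): eventually, with probability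
  `≤ θ`, the chain visits the `ε`-neighbourhood of `∂D` at a point `ρ`-far from both marked points.
* S3 `stub_anchorDecayPassage` (M, soft) — PASSAGE: for a chordal `P` and an admissible approximation along
  which the chain laws converge to `P D`, the two decays force `P D`-a.e. simplicity and boundary avoidance
  (transcription of `FarPast.Passage.ae_simple_of_farReturnDecayAt` / `Boundary.Passage.ae_boundary_of_boundaryDecayAt`
  from the lattice laws to an abstract family of eventually-probability laws: open-set portmanteau along
  `𝓝[>] 0`, countable Gaussian-rational data, the landed deterministic closing lemmas; chordality supplies the
  endpoints and the confinement of the limit curve).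

`AnchorSimpleBoundary_of : S1 → S2 → S3 → AnchorSimpleBoundary`: fix `P`, `D`, pick an admissible
approximation (`(approx)`), run S3 on `(lim)` and the two decays along it.

References: G. F. Lawler, O. Schramm, W. Werner (2004), arXiv:math/0204277, §3.4.5; T. Kennedy,
G. F. Lawler, *Lattice effects in the scaling limit of the two-dimensional self-avoiding walk* (2013),
arXiv:1109.3091; H. Duminil-Copin, A. Hammond, *Self-avoiding walk is sub-ballistic* (2013); S. Rohde,
O. Schramm, *Basic properties of SLE* (2005). All [folklore] at the level of statements.
-/

noncomputable section

open scoped BigOperators Topology Classical MeasureTheory ProbabilityTheory ComplexConjugate ContinuousMap ENNReal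
open MeasureTheory Filter Set Function TopologicalSpace
open Literature.Probability.LatticeModels Literature.Probability.RandomPlanarGeometry

open Summit.CriticalPhenomena.SAWScalingLimit.Theorems.SimpleSubseqLimits.FarPast.Passage (nearFarReturnEvent)
open Summit.CriticalPhenomena.SAWScalingLimit.Theorems.SimpleSubseqLimits.Boundary.Passage (nearBoundaryVisitEvent)

namespace Summit.CriticalPhenomena.SAWScalingLimit.Cruxes.AnchorAxiomsOfLimit.SimpleBirth

/-- **The split child X4 `AnchorSimpleBoundary`** (verbatim the statement filed for the route-level split;
= `stub_anchorSimpleBoundary` of `Lines/split.lean`). [cite: LawlerSchrammWerner2004SAW, §3.4.5] -/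
def AnchorSimpleBoundary : Prop :=
  let fjc : ℝ → Set ℂ → ℂ → ℂ → MeasureTheory.Measure (Literature.Probability.RandomPlanarGeometry.CurveClass ℂ) := fun ℓ Ω x y => (let S : (N : ℕ) → (Fin N → ℝ) → Fin (N + 1) → ℂ := fun N θ k => ∑ j : Fin N, if (j : ℕ) < (k : ℕ) then Complex.exp (Complex.I * (θ j : ℂ)) else 0; let C : (N : ℕ) → (Fin (N + 1) → ℂ) → Literature.Probability.RandomPlanarGeometry.CurveClass ℂ := fun _ v => Literature.Probability.RandomPlanarGeometry.CurveClass.mk ⟨Literature.Probability.LatticeModels.polyline (List.ofFn v)⟩; let Z : ℕ → ℝ := fun N => ((MeasureTheory.volume : MeasureTheory.Measure (Fin N → ℝ)) {θ | (∀ j, θ j ∈ Set.Ico (0 : ℝ) (2 * Real.pi)) ∧ C N (S N θ) ∈ Literature.Probability.RandomPlanarGeometry.CurveClass.simple}).toReal / (2 * Real.pi) ^ N; let μ : ℝ := ⨅ N : ℕ, Z (N + 1) ^ (1 / ((N : ℝ) + 1)); let V : (N : ℕ) → ℂ × (Fin N → ℝ) → Literature.Probability.RandomPlanarGeometry.CurveClass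 ℂ := fun N p => C N (fun k => p.1 + (ℓ : ℂ) * S N p.2 k); let E : Set (Literature.Probability.RandomPlanarGeometry.CurveClass ℂ) := {c | c ∈ Literature.Probability.RandomPlanarGeometry.CurveClass.simple ∧ c.range ⊆ closure Ω ∧ c.target ∈ Metric.ball y ℓ}; let W : MeasureTheory.Measure (Literature.Probability.RandomPlanarGeometry.CurveClass ℂ) := MeasureTheory.Measure.sum fun N : ℕ => ENNReal.ofReal ((μ⁻¹ / (2 * Real.pi)) ^ N) • ((((MeasureTheory.volume.restrict (Metric.ball x ℓ)).prod (MeasureTheory.volume.restrict (Set.univ.pi fun _ : Fin N => Set.Ico (0 : ℝ) (2 * Real.pi)))).restrict (V N ⁻¹' E)).map (V N)); (W Set.univ)⁻¹ • W); ∀ P : Literature.Probability.RandomPlanarGeometry.ChordalFamily, P.IsChordal → (∀ D : Literature.Probability.RandomPlanarGeometry.DobrushinDomain, ∃ a' b' : ℝ → ℂ, (Filter.Tendsto a' (nhdsWithin 0 (Set.Ioi 0)) (nhds (D.pt 0)) ∧ Filter.Tendsto b' (nhdsWithin 0 (Set.Ioi 0)) (nhds (D.pt 1)) ∧ ∀ᶠ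 ℓ in nhdsWithin 0 (Set.Ioi 0), MeasureTheory.IsProbabilityMeasure (fjc ℓ D.carrier (a' ℓ) (b' ℓ)))) → (∀ (D : Literature.Probability.RandomPlanarGeometry.DobrushinDomain) (a' b' : ℝ → ℂ), (Filter.Tendsto a' (nhdsWithin 0 (Set.Ioi 0)) (nhds (D.pt 0)) ∧ Filter.Tendsto b' (nhdsWithin 0 (Set.Ioi 0)) (nhds (D.pt 1)) ∧ ∀ᶠ ℓ in nhdsWithin 0 (Set.Ioi 0), MeasureTheory.IsProbabilityMeasure (fjc ℓ D.carrier (a' ℓ) (b' ℓ))) → Literature.Probability.RandomPlanarGeometry.TendstoLaw (fun (_ : ℝ) (c : Literature.Probability.RandomPlanarGeometry.CurveClass ℂ) => c) (fun ℓ => fjc ℓ D.carrier (a' ℓ) (b' ℓ)) id (P D)) → ∀ D : Literature.Probability.RandomPlanarGeometry.DobrushinDomain, ∀ᵐ γ ∂(P D), γ ∈ Literature.Probability.RandomPlanarGeometry.CurveClass.simple ∧ γ.range ∩ frontier D.carrier ⊆ {D.pt 0, D.pt 1}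

/-! ### Vocabulary (the anchor law named; admissibility; full limit) — as in `Lines/split.lean` -/

/-- The critical freely-jointed non-crossing chain law, verbatim the `let fjc := …` inlined in the
route items. [cite: LawlerSchrammWerner2004SAW, §3.4.2] -/
def fjc : ℝ → Set ℂ → ℂ → ℂ → MeasureTheory.Measure (Literature.Probability.RandomPlanarGeometry.CurveClass ℂ) :=
  fun ℓ Ω x y => (let S : (N : ℕ) → (Fin N → ℝ) → Fin (N + 1) → ℂ := fun N θ k => ∑ j : Fin N, if (j : ℕ) < (k : ℕ) then Complex.exp (Complex.I * (θ j : ℂ)) else 0; let C : (N : ℕ) → (Fin (N + 1) → ℂ) → Literature.Probability.RandomPlanarGeometry.CurveClass ℂ := fun _ v => Literature.Probability.RandomPlanarGeometry.CurveClass.mk ⟨Literature.Probability.LatticeModels.polyline (List.ofFn v)⟩; let Z : ℕ → ℝ := fun N => ((MeasureTheory.volume : MeasureTheory.Measure (Fin N → ℝ)) {θ | (∀ j, θ j ∈ Set.Ico (0 : ℝ) (2 * Real.pi)) ∧ C N (S N θ) ∈ Literature.Probability.RandomPlanarGeometry.CurveClass.simple}).toReal / (2 * Real.pi) ^ N; let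 μ : ℝ := ⨅ N : ℕ, Z (N + 1) ^ (1 / ((N : ℝ) + 1)); let V : (N : ℕ) → ℂ × (Fin N → ℝ) → Literature.Probability.RandomPlanarGeometry.CurveClass ℂ := fun N p => C N (fun k => p.1 + (ℓ : ℂ) * S N p.2 k); let E : Set (Literature.Probability.RandomPlanarGeometry.CurveClass ℂ) := {c | c ∈ Literature.Probability.RandomPlanarGeometry.CurveClass.simple ∧ c.range ⊆ closure Ω ∧ c.target ∈ Metric.ball y ℓ}; let W : MeasureTheory.Measure (Literature.Probability.RandomPlanarGeometry.CurveClass ℂ) := MeasureTheory.Measure.sum fun N : ℕ => ENNReal.ofReal ((μ⁻¹ / (2 * Real.pi)) ^ N) • ((((MeasureTheory.volume.restrict (Metric.ball x ℓ)).prod (MeasureTheory.volume.restrict (Set.univ.pi fun _ : Fin N => Set.Ico (0 : ℝ) (2 * Real.pi)))).restrict (V N ⁻¹' E)).map (V N)); (W Set.univ)⁻¹ • W)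

variable {F : ℝ → Set ℂ → ℂ → ℂ → Measure (CurveClass ℂ)} {P : ChordalFamily}

/-- Admissible endpoint approximation of `D` for the law family `F` (verbatim the inlined clause). [folklore] -/
def Adm (F : ℝ → Set ℂ → ℂ → ℂ → Measure (CurveClass ℂ)) (D : DobrushinDomain) (a' b' : ℝ → ℂ) : Prop :=
  Filter.Tendsto a' (nhdsWithin 0 (Set.Ioi 0)) (nhds (D.pt 0)) ∧
    Filter.Tendsto b' (nhdsWithin 0 (Set.Ioi 0)) (nhds (D.pt 1)) ∧
      ∀ᶠ ℓ in nhdsWithin 0 (Set.Ioi 0), MeasureTheory.IsProbabilityMeasure (F ℓ D.carrier (a' ℓ) (b' ℓ))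

/-- `(approx)`: every Dobrushin domain admits an admissible approximation. [folklore] -/
def Approx (F : ℝ → Set ℂ → ℂ → ℂ → Measure (CurveClass ℂ)) : Prop :=
  ∀ D : DobrushinDomain, ∃ a' b' : ℝ → ℂ, Adm F D a' b'

/-- `(lim)`: `P` is the full scaling limit of `F` along every admissible approximation. [folklore] -/
def Lim (F : ℝ → Set ℂ → ℂ → ℂ → Measure (CurveClass ℂ)) (P : ChordalFamily) : Prop :=
  ∀ (D : DobrushinDomain) (a' b' : ℝ → ℂ), Adm F D a' b' →
    TendstoLaw (fun (_ : ℝ) (c : CurveClass ℂ) => c) (fun ℓ => F ℓ D.carrier (a' ℓ) (b' ℓ)) id (P D)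

/-- Clause (5): simple curves meeting `∂D` only at the marked points. [folklore] -/
def SimpleBd (P : ChordalFamily) : Prop :=
  ∀ D : DobrushinDomain, ∀ᵐ γ ∂(P D), γ ∈ CurveClass.simple ∧ γ.range ∩ frontier D.carrier ⊆ {D.pt 0, D.pt 1}

/-- **Far-return decay of the chain at `(D; a, b)`** (ORDER input, first-entrance slit avoidance, on the
thickened far-return events of the lattice programme). [folklore] -/
def FarReturnDecayAt (F : ℝ → Set ℂ → ℂ → ℂ → Measure (CurveClass ℂ)) (D : DobrushinDomain)
    (a b : ℝ → ℂ) : Prop :=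
  ∀ (q : ℂ) (r θ : ℝ), 0 < r → 0 < θ → ∃ ε r₀ r' : ℝ, 0 < ε ∧ 0 < r₀ ∧ r₀ < r ∧ r < r' ∧
    ∀ᶠ ℓ in 𝓝[>] (0 : ℝ),
      F ℓ D.carrier (a ℓ) (b ℓ) (nearFarReturnEvent q r₀ r r' ε) ≤ ENNReal.ofReal θ

/-- **Boundary decay of the chain at `(D; a, b)`** (BOUNDARY input, "no boundary crawling", on the
near-boundary-visit events of the lattice programme). [folklore] -/
def BoundaryDecayAt (F : ℝ → Set ℂ → ℂ → ℂ → Measure (CurveClass ℂ)) (D : DobrushinDomain)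
    (a b : ℝ → ℂ) : Prop :=
  ∀ ρ θ : ℝ, 0 < ρ → 0 < θ → ∃ ε : ℝ, 0 < ε ∧
    ∀ᶠ ℓ in 𝓝[>] (0 : ℝ), F ℓ D.carrier (a ℓ) (b ℓ) (nearBoundaryVisitEvent D ρ ε) ≤ ENNReal.ofReal θ

/-! ### The stubs (the ONLY `sorry`s of this file) -/

/-- **S1 (open) — far-return decay of the critical chain along every admissible approximation.**
[cite: LawlerSchrammWerner2004SAW, §3.4.5] -/
theorem stub_anchorFarReturnDecay :
    ∀ (D : DobrushinDomain) (a b : ℝ → ℂ), Adm fjc D a b → FarReturnDecayAt fjc D a b := by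
  sorry

/-- **S2 (open) — boundary decay of the critical chain along every admissible approximation.**
[cite: KennedyLawler2013, p. 11] -/
theorem stub_anchorBoundaryDecay :
    ∀ (D : DobrushinDomain) (a b : ℝ → ℂ), Adm fjc D a b → BoundaryDecayAt fjc D a b := by
  sorry

/-- **S3 (soft) — the passage**: along an admissible approximation converging to `P D` (`P` chordal), the two
decays force `P D`-a.e. simple classes meeting `∂D` only at the marked points (open-set portmanteau + the
landed deterministic closing lemmas). [cite: AizenmanBurchard1999, §2.1] -/
theorem stub_anchorDecayPassage :
    ∀ P : ChordalFamily, P.IsChordal → ∀ (D : DobrushinDomain) (a b : ℝ → ℂ), Adm fjc D a b →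
      TendstoLaw (fun (_ : ℝ) (c : CurveClass ℂ) => c) (fun ℓ => fjc ℓ D.carrier (a ℓ) (b ℓ)) id (P D) →
        FarReturnDecayAt fjc D a b → BoundaryDecayAt fjc D a b →
          ∀ᵐ γ ∂(P D), γ ∈ CurveClass.simple ∧ γ.range ∩ frontier D.carrier ⊆ {D.pt 0, D.pt 1} := by
  sorry

/-! ### Name-keyed aliases (skeleton-check convention) -/

namespace __Registered

/-- Alias keyed by the registered stub name. -/
abbrev stub_anchorFarReturnDecay : Prop :=
  ∀ (D : DobrushinDomain) (a b : ℝ → ℂ), Adm fjc D a b → FarReturnDecayAt fjc D a b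
/-- Alias keyed by the registered stub name. -/
abbrev stub_anchorBoundaryDecay : Prop :=
  ∀ (D : DobrushinDomain) (a b : ℝ → ℂ), Adm fjc D a b → BoundaryDecayAt fjc D a b
/-- Alias keyed by the registered stub name. -/
abbrev stub_anchorDecayPassage : Prop :=
  ∀ P : ChordalFamily, P.IsChordal → ∀ (D : DobrushinDomain) (a b : ℝ → ℂ), Adm fjc D a b →
    TendstoLaw (fun (_ : ℝ) (c : CurveClass ℂ) => c) (fun ℓ => fjc ℓ D.carrier (a ℓ) (b ℓ)) id (P D) →
      FarReturnDecayAt fjc D a b → BoundaryDecayAt fjc D a b →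
        ∀ᵐ γ ∂(P D), γ ∈ CurveClass.simple ∧ γ.range ∩ frontier D.carrier ⊆ {D.pt 0, D.pt 1}

end __Registered

/-- The child IS the generic simplicity piece at the named law (definitionally). [folklore] -/
theorem anchorSimpleBoundary_iff :
    AnchorSimpleBoundary ↔ ∀ P : ChordalFamily, P.IsChordal → Approx fjc → Lim fjc P → SimpleBd P :=
  Iff.rfl

/-! ### The skeleton theorem -/

/-- **`AnchorSimpleBoundary` from S1, S2, S3** (no `sorry` of its own): pick an admissible approximation of
`D`, run the passage S3 on `(lim)` and the two decays along it. [folklore] -/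
theorem AnchorSimpleBoundary_of (h₁ : __Registered.stub_anchorFarReturnDecay)
    (h₂ : __Registered.stub_anchorBoundaryDecay) (h₃ : __Registered.stub_anchorDecayPassage) :
    AnchorSimpleBoundary :=
  anchorSimpleBoundary_iff.2 fun P hch happ hlim D => by
    obtain ⟨a, b, hab⟩ := happ D
    exact h₃ P hch D a b hab (hlim D a b hab) (h₁ D a b hab) (h₂ D a b hab)

/-- Wiring check. -/
example : AnchorSimpleBoundary :=
  AnchorSimpleBoundary_of stub_anchorFarReturnDecay stub_anchorBoundaryDecay stub_anchorDecayPassage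

end Summit.CriticalPhenomena.SAWScalingLimit.Cruxes.AnchorAxiomsOfLimit.SimpleBirth

end
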